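import Literature.NumberTheory.Transcendental.PadicCW77Series
import Literature.NumberTheory.Transcendental.PadicSmallJetsSchwarzLevels
import HarnessLib

/-!
# The `p`-adic extrapolation step (k-step) of the Cijsouw–Waldschmidt / Waldschmidt descent

Support file (definitions-free; proved theorems only; no named fact), sequel to
`PadicCW77Series.lean` (cell `abc-stewartyu`, WP-A5, the twin of the tree's archimedean
`Waldschmidt1980.…w80_kstep`). At level `J`, suppose the rational numbers
`coreSum_{J,τ''}(s') = φ_{J,τ''}(s')` vanish at the odd points `s' = 2i+1 < 2·kpts` for all
`|τ''| < Tlo`, and that the linear form is small, `‖Λ₀‖_p ≤ p⁻¹`. Then for `|τ| + t ≤ Tlo`: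

1. at each node `a = 2i+1` every `f_{J,τ'}(a)`, `|τ'| < Tlo`, has norm `≤ p^{hLb} ‖Λ₀‖`
   (Lemma 9, `norm_F_sub_Φ_le`, since `φ_{J,τ'}(a) = coreSum = 0`), hence the jets of order `< t`
   of the power series of `f_{J,τ}` at the nodes are `≤ (√p)^t p^{hLb} ‖Λ₀‖`
   (`norm_jet_F_le`; the factor `‖1/k!‖ ≤ (√p)^k`);
2. the small-jets Schwarz lemma on the disc of radius `√p` with the `kpts` nodes (pairwise at
   `p`-adic distance `≥ 1/(2 kpts)`), each of multiplicity `t`, bounds `f_{J,τ}` at any point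
   `s₁` of the unit disc by `max ((√p)^t p^{hLb} ‖Λ₀‖ p^{condExp}) (p^{hLb} (√p)^{-kpts·t})`,
   `condExp = ∑_{j≥1} t(⌊kpts/p^j⌋ + 1) ≤ t(kpts/(p−1) + log_p(2kpts) + 1)` (sharp ultrametric
   conditioning from the level version of the small-jets lemma);
3. so `‖coreSum_{J,τ}(s₁)‖_p = ‖φ_{J,τ}(s₁)‖_p` is at most the same `max` (Lemma 9 again), and if
   this is `< 1/(D·M)` where `D · coreSum ∈ ℤ` and `|coreSum| ≤ M` (archimedean data from the
   heights, supplied by the caller), the PRODUCT FORMULA forces `coreSum_{J,τ}(s₁) = 0`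
   (`Rat.eq_zero_of_padicNorm_lt`).

This is `padic_kstep`. No growth term and no `P = max |p(u)|` appear (the `p(u)` are integers and
`‖exp‖ = 1`); the archimedean sizes enter only through `D` and `M`.

## References
* [Yu1990] K. Yu, *Linear forms in p-adic logarithms II*, Compositio Math. 74 (1990), §3
  (extrapolation) and Lemma 2.5 (the Liouville step via the product formula).
* [Waldschmidt1980] M. Waldschmidt, Acta Arith. 37 (1980), Lemma 3.5 (the archimedean k-step).
-/

noncomputable section

open NormedSpace Finset IsUltrametricDist Polynomial Metric Filter
open Literature.NumberTheory.Transcendental.Baker1975.Ch3 (wDen)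
open scoped Nat Topology

namespace Literature.NumberTheory.Transcendental

namespace PadicCW77

open CW77.Setup (Idx Tau tauNorm)

/-! ### The node sequence: each node repeated `t` times -/

/-- The node sequence `node 0, …, node 0, node 1, …` (each `t` times). [cite: Yu1990, §3] -/
def nodeSeq {K : Type*} (node : ℕ → K) (kpts t : ℕ) : List K :=
  (List.range kpts).flatMap fun i => List.replicate t (node i)

/-- Length of the node sequence. [cite: Yu1990, §3] -/
theorem length_nodeSeq {K : Type*} (node : ℕ → K) (kpts t : ℕ) :
    (nodeSeq node kpts t).length = kpts * t := by
  induction kpts with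
  | zero => simp [nodeSeq]
  | succ k ih =>
    unfold nodeSeq at ih ⊢
    rw [List.range_succ, List.flatMap_append, List.length_append, ih]
    simp [Nat.succ_mul]

/-- Members of the node sequence are nodes. [cite: Yu1990, §3] -/
theorem mem_nodeSeq {K : Type*} {node : ℕ → K} {kpts t : ℕ} {x : K} (hx : x ∈ nodeSeq node kpts t) :
    ∃ i < kpts, x = node i := by
  unfold nodeSeq at hx
  rw [List.mem_flatMap] at hx
  obtain ⟨i, hi, hx⟩ := hx
  exact ⟨i, List.mem_range.mp hi, List.eq_of_mem_replicate hx⟩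

/-- Multiplicity in the node sequence (injective `node`). [cite: Yu1990, §3] -/
theorem count_nodeSeq {K : Type*} [DecidableEq K] {node : ℕ → K} (hnode : Function.Injective node)
    (t : ℕ) : ∀ (kpts i : ℕ), (nodeSeq node kpts t).count (node i) = if i < kpts then t else 0 := by
  intro kpts
  induction kpts with
  | zero => intro i; simp [nodeSeq]
  | succ k ih =>
    intro i
    unfold nodeSeq at ih ⊢
    rw [List.range_succ, List.flatMap_append, List.count_append, ih i, List.flatMap_cons,
      List.flatMap_nil, List.append_nil, List.count_replicate]
    by_cases hik : i < k
    · have hne : (node k == node i) = false := by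
        rw [beq_eq_false_iff_ne]; exact fun h => by have := hnode h; omega
      rw [hne, if_pos hik, if_pos (Nat.lt_succ_of_lt hik)]
      simp
    · by_cases hik' : i = k
      · subst hik'
        rw [if_neg hik, beq_self_eq_true, if_pos (Nat.lt_succ_self i)]
        simp
      · have hne : (node k == node i) = false := by
          rw [beq_eq_false_iff_ne]; exact fun h => hik' (hnode h).symm
        have hlt : ¬ i < k + 1 := by omega
        simp [hne, hik, hlt]

/-- `countP` over the node sequence. [cite: Yu1990, §3] -/
theorem countP_nodeSeq {K : Type*} (node : ℕ → K) (q : K → Bool) (t : ℕ) :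
    ∀ kpts : ℕ, (nodeSeq node kpts t).countP q = ∑ i ∈ range kpts, if q (node i) then t else 0 := by
  intro kpts
  induction kpts with
  | zero => simp [nodeSeq]
  | succ k ih =>
    unfold nodeSeq at ih ⊢
    rw [List.range_succ, List.flatMap_append, List.countP_append, ih, Finset.sum_range_succ,
      List.flatMap_cons, List.flatMap_nil, List.append_nil, List.countP_replicate]

/-- Residue classes in a range: `#{i < kpts : i ≡ c (mod M)} ≤ kpts / M + 1`. [cite: Yu1990, §3] -/
theorem card_filter_range_mod_le (kpts M c : ℕ) :
    ((range kpts).filter fun i => i % M = c).card ≤ kpts / M + 1 := by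
  calc ((range kpts).filter fun i => i % M = c).card
      ≤ (range (kpts / M + 1)).card := by
        refine Finset.card_le_card_of_injOn (fun i => i / M) (fun i hi => ?_) ?_
        · rw [Finset.mem_coe, Finset.mem_filter, Finset.mem_range] at hi
          rw [Finset.mem_coe, Finset.mem_range, Nat.lt_succ_iff]
          exact Nat.div_le_div_right hi.1.le
        · intro i hi i' hi' h
          simp only at h
          rw [Finset.mem_coe, Finset.mem_filter] at hi hi'
          have e1 := Nat.div_add_mod i M
          have e2 := Nat.div_add_mod i' M
          rw [hi.2, h] at e1
          rw [hi'.2] at e2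
          omega
    _ = kpts / M + 1 := Finset.card_range _

/-- **The conditioning exponent** of `kpts` consecutive odd integer nodes of multiplicity `t` in
`ℚ_p`: `∑_{j=1}^{J} t (⌊kpts/p^j⌋ + 1)`, `J = ⌊log_p (2 kpts)⌋` (levels beyond the largest `p`-adic
valuation of a difference of nodes cost nothing; `condExp = 0` when `p > 2 kpts`; in general
`condExp · log p ≤ kpts·t·log p/(p−1) + t·log(2 kpts)` — `p`-uniform). [cite: Yu1990, §3] -/
def condExp (p kpts t : ℕ) : ℕ :=
  ∑ j ∈ range (Nat.log p (2 * kpts)), t * (kpts / p ^ (j + 1) + 1)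

namespace Setup

variable (S : Setup) {h Lb : ℕ}

/-! ### Size of the `Δ`-factor on the unit disc -/

/-- `‖Dw(z)‖ ≤ p^{h Lb}` for `‖z‖ ≤ 1` (ultrametric: `≤ max ‖coeff‖ ≤ ‖wDen⁻¹‖ ≤ p^{hLb}`).
[cite: CijsouwWaldschmidt1977, §4 Lemma 8 (p. 185)] -/
theorem norm_Dw_le (J₀ J : ℕ) (u : Idx S.d h Lb) (τ₀ : ℕ) {z : ℚ_[S.p]} (hz : ‖z‖ ≤ 1) :
    ‖S.Dw J₀ J u τ₀ z‖ ≤ (S.p : ℝ) ^ (h * Lb) := by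
  have hp1 : (1 : ℝ) ≤ Real.sqrt S.p := by
    rw [Real.le_sqrt zero_le_one (by positivity)]; simpa using S.one_lt_p.le
  rw [S.Dw_eq_sum]
  refine norm_sum_le_of_forall_le_of_nonneg (by positivity) fun i _ => ?_
  rw [norm_mul, norm_pow]
  calc ‖S.wC J₀ J u τ₀ i‖ * ‖z‖ ^ i ≤ ‖S.wC J₀ J u τ₀ i‖ * 1 :=
        mul_le_mul_of_nonneg_left (pow_le_one₀ (norm_nonneg _) hz) (norm_nonneg _)
    _ ≤ ‖S.wC J₀ J u τ₀ i‖ * Real.sqrt S.p ^ i :=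
        mul_le_mul_of_nonneg_left (one_le_pow₀ hp1) (norm_nonneg _)
    _ ≤ (S.p : ℝ) ^ (h * Lb) := S.norm_wC_mul_le J₀ J u τ₀ i

/-- Legendre: `(p − 1) · v_p(n!) ≤ n − 1`, hence `v_p(n!) ≤ (n − 1)/(p − 1)`. [cite: Yu1990, §1.1] -/
theorem padicValNat_factorial_le (n : ℕ) : padicValNat S.p n ! ≤ (n - 1) / (S.p - 1) := by
  have hp2 : 2 ≤ S.p := S.hp.two_le
  rcases Nat.eq_zero_or_pos n with rfl | hn
  · simp
  · have h := sub_one_mul_padicValNat_factorial_lt_of_ne_zero S.p hn.ne'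
    rw [Nat.le_div_iff_mul_le (by omega)]
    rw [mul_comm] at h; omega

/-- `‖(n!)⁻¹‖_p = p^{v_p(n!)} ≤ p^{(n−1)/(p−1)}` (the SHARP size of `1/n!`; `p`-bounded exponent).
[cite: Yu1990, §1.1] -/
theorem norm_inv_factorial_le_pow_div (n : ℕ) :
    ‖((n ! : ℕ) : ℚ_[S.p])⁻¹‖ ≤ (S.p : ℝ) ^ ((n - 1) / (S.p - 1)) := by
  have hne : ((n ! : ℕ) : ℚ_[S.p]) ≠ 0 := by exact_mod_cast n.factorial_ne_zero
  rw [norm_inv, Padic.norm_eq_zpow_neg_valuation hne, Padic.valuation_natCast, zpow_neg, inv_inv,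
    zpow_natCast]
  exact pow_le_pow_right₀ (by exact_mod_cast S.hp.one_lt.le) (S.padicValNat_factorial_le n)

/-- `v_p(wDen r l h) ≤ hLb/(p−1)` for `r < h`, `l < Lb` (`wDen = r! h!ˡ`, Legendre).
[cite: CijsouwWaldschmidt1977, §4 Lemma 8 (p. 185)] -/
theorem padicValNat_wDen_le (u : Idx S.d h Lb) :
    padicValNat S.p (wDen (u.1.1 : ℕ) (u.1.2 : ℕ) h) ≤ h * Lb / (S.p - 1) := by
  have hp2 : 2 ≤ S.p := S.hp.two_le
  have hr : (u.1.1 : ℕ) < h := u.1.1.isLt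
  have hl : (u.1.2 : ℕ) < Lb := u.1.2.isLt
  unfold wDen
  rw [padicValNat.mul (Nat.factorial_ne_zero _) (pow_ne_zero _ (Nat.factorial_ne_zero _)),
    padicValNat.pow]
  have h1 := sub_one_mul_padicValNat_factorial_lt_of_ne_zero S.p (show h ≠ 0 by omega)
  have h2 : (S.p - 1) * padicValNat S.p (u.1.1 : ℕ)! ≤ (u.1.1 : ℕ) := by
    rcases Nat.eq_zero_or_pos (u.1.1 : ℕ) with h0 | hpos
    · rw [h0]; simp
    · exact (sub_one_mul_padicValNat_factorial_lt_of_ne_zero S.p hpos.ne').le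
  rw [Nat.le_div_iff_mul_le (by omega)]
  have h3 : (padicValNat S.p (u.1.1 : ℕ)! + (u.1.2 : ℕ) * padicValNat S.p h !) * (S.p - 1) ≤
      (u.1.1 : ℕ) + (u.1.2 : ℕ) * h := by
    have := Nat.mul_le_mul_left (u.1.2 : ℕ) h1.le
    nlinarith
  calc (padicValNat S.p (u.1.1 : ℕ)! + (u.1.2 : ℕ) * padicValNat S.p h !) * (S.p - 1)
      ≤ (u.1.1 : ℕ) + (u.1.2 : ℕ) * h := h3
    _ ≤ h * Lb := by nlinarith

/-- **The SHARP size of the `Δ`-factor on the unit disc**: `‖Dw(z)‖ ≤ ‖wDen⁻¹‖_p ≤ p^{hLb/(p−1)}`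
(`p`-bounded exponent; ultrametric maximum over the coefficients, which are integers/`wDen`).
[cite: CijsouwWaldschmidt1977, §4 Lemma 8 (p. 185)] -/
theorem norm_Dw_le_sharp (J₀ J : ℕ) (u : Idx S.d h Lb) (τ₀ : ℕ) {z : ℚ_[S.p]} (hz : ‖z‖ ≤ 1) :
    ‖S.Dw J₀ J u τ₀ z‖ ≤ (S.p : ℝ) ^ (h * Lb / (S.p - 1)) := by
  have hden : (wDen (u.1.1 : ℕ) (u.1.2 : ℕ) h : ℚ_[S.p]) ≠ 0 := by
    exact_mod_cast (Literature.NumberTheory.Transcendental.Baker1975.Ch3.wDen_pos _ _ _).ne'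
  have hW : ‖((wDen (u.1.1 : ℕ) (u.1.2 : ℕ) h : ℕ) : ℚ_[S.p])⁻¹‖ ≤ (S.p : ℝ) ^ (h * Lb / (S.p - 1)) := by
    rw [norm_inv, Padic.norm_eq_zpow_neg_valuation hden, Padic.valuation_natCast, zpow_neg, inv_inv,
      zpow_natCast]
    exact pow_le_pow_right₀ (by exact_mod_cast S.hp.one_lt.le) (S.padicValNat_wDen_le u)
  rw [S.Dw_eq_sum]
  refine norm_sum_le_of_forall_le_of_nonneg (by positivity) fun i _ => ?_
  rw [norm_mul, norm_pow]
  calc ‖S.wC J₀ J u τ₀ i‖ * ‖z‖ ^ i ≤ ‖S.wC J₀ J u τ₀ i‖ * 1 :=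
        mul_le_mul_of_nonneg_left (pow_le_one₀ (norm_nonneg _) hz) (norm_nonneg _)
    _ ≤ (S.p : ℝ) ^ (h * Lb / (S.p - 1)) := by
        rw [mul_one]; exact (S.norm_coeff_iterate_derivative_wOf_le J₀ J u τ₀ i).trans hW

/-! ### The extrapolation bound on the unit disc -/

/-- **The `p`-adic extrapolation bound** (steps 1–2 of the k-step, usable at integer AND
half-integer points): if the rational cores `coreSum_{J,τ''}(2i+1)` vanish for `i < kpts`,
`|τ''| < Tlo`, and `‖Λ₀‖_p ≤ p⁻¹`, then for every `z` of the unit disc and every `|τ| + t ≤ Tlo`,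
`‖φ_{J,τ}(z)‖_p ≤ max (p^{⌊hLb/(p−1)⌋} ‖Λ₀‖ p^{⌊(t−1)/(p−1)⌋} p^{condExp}) (p^{hLb} / (√p)^{kpts·t})` (all
exponents of the first branch are `p`-bounded: sharp sizes of `Δ(s)` and of `1/k!`), with the sharp
ultrametric conditioning `condExp = ∑_{j≥1} t(⌊kpts/p^j⌋+1)` (the level version of the small-jets
Schwarz lemma: the nodes `2i+1` at `p`-adic distance `≤ p^{-j}` from a given one are those with
`i` in one residue class mod `p^j`). The same bound holds for `f_{J,τ}(z)`.
[cite: Yu1990, §3] [cite: Waldschmidt1980, Lemma 3.5 (p. 270)] -/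
theorem norm_Φ_le_of_zeros (J₀ J : ℕ) (box : Finset (Idx S.d h Lb)) (p : Idx S.d h Lb → ℤ)
    {kpts Tlo t : ℕ} (ht : 1 ≤ t)
    (hzero : ∀ i < kpts, ∀ τ'' : Tau S.d, tauNorm τ'' < Tlo →
      S.coreSum J₀ J box p τ'' (2 * i + 1) = 0)
    (hΛ : ‖S.Λ₀‖ ≤ (S.p : ℝ)⁻¹) {z : ℚ_[S.p]} (hz : ‖z‖ ≤ 1)
    (τ : Tau S.d) (hτ : tauNorm τ + t ≤ Tlo) :
    ‖S.F J₀ J box p τ z‖ ≤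
        max ((S.p : ℝ) ^ (h * Lb / (S.p - 1)) * ‖S.Λ₀‖ * (S.p : ℝ) ^ ((t - 1) / (S.p - 1)) *
            (S.p : ℝ) ^ condExp S.p kpts t)
          ((S.p : ℝ) ^ (h * Lb) / Real.sqrt S.p ^ (kpts * t)) ∧
      ‖S.Φ J₀ J box p τ z‖ ≤
        max ((S.p : ℝ) ^ (h * Lb / (S.p - 1)) * ‖S.Λ₀‖ * (S.p : ℝ) ^ ((t - 1) / (S.p - 1)) *
            (S.p : ℝ) ^ condExp S.p kpts t)
          ((S.p : ℝ) ^ (h * Lb) / Real.sqrt S.p ^ (kpts * t)) := by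
  classical
  have hTlo : 1 ≤ Tlo := by omega
  have hprime : S.p.Prime := S.hp
  have hp0 : (0 : ℝ) < S.p := by exact_mod_cast hprime.pos
  -- notation: `B` = the weighted coefficient bound (radius √p), `Q` = the SHARP value bound on the
  -- unit disc (`p`-bounded exponent), `Pt` = the sharp size of `1/k!`, `k < t`
  set B : ℝ := (S.p : ℝ) ^ (h * Lb) with hB
  set Q : ℝ := (S.p : ℝ) ^ (h * Lb / (S.p - 1)) with hQ
  set Pt : ℝ := (S.p : ℝ) ^ ((t - 1) / (S.p - 1)) with hPt
  set ρ : ℝ := Real.sqrt S.p with hρdef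
  have hρ : 0 < ρ := S.sqrt_p_pos
  have h1ρ : (1 : ℝ) < ρ := by
    rw [hρdef, Real.lt_sqrt zero_le_one]; norm_num; exact_mod_cast S.hp.one_lt
  have h1p : (1 : ℝ) ≤ S.p := by exact_mod_cast hprime.one_lt.le
  have hQ0 : 0 ≤ Q := by positivity
  have hΛ0 : 0 ≤ ‖S.Λ₀‖ := norm_nonneg _
  -- (a) Lemma 9 on the unit disc (sharp form)
  have hFΦ : ∀ (τ' : Tau S.d) (z : ℚ_[S.p]), ‖z‖ ≤ 1 →
      ‖S.F J₀ J box p τ' z - S.Φ J₀ J box p τ' z‖ ≤ Q * ‖S.Λ₀‖ := fun τ' z hz =>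
    S.norm_F_sub_Φ_le J₀ J box p τ' hΛ hz hQ0 fun u _ => S.norm_Dw_le_sharp J₀ J u τ'.1 hz
  -- natural numbers lie in the unit disc
  have hnat : ∀ n : ℕ, ‖(n : ℚ_[S.p])‖ ≤ 1 := fun n => by
    exact_mod_cast Padic.norm_int_le_one (p := S.p) (n : ℤ)
  -- (b) values at the nodes
  have hval : ∀ i < kpts, ∀ τ' : Tau S.d, tauNorm τ' ≤ Tlo - 1 →
      ‖S.F J₀ J box p τ' ((2 * i + 1 : ℕ) : ℚ_[S.p])‖ ≤ Q * ‖S.Λ₀‖ := by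
    intro i hi τ' hτ'
    have h0 : S.Φ J₀ J box p τ' ((2 * i + 1 : ℕ) : ℚ_[S.p]) = 0 := by
      rw [S.Φ_natCast, hzero i hi τ' (by omega), Rat.cast_zero]
    have := hFΦ τ' _ (hnat (2 * i + 1))
    rwa [h0, sub_zero] at this
  -- the coefficient sequence and its weighted bound
  set b : ℕ → ℚ_[S.p] := S.coeffF J₀ J box p τ with hb
  have hbB : PadicNewton.WtBdd ρ B b := S.wtBdd_coeffF J₀ J box p τ
  -- the nodes
  set node : ℕ → ℚ_[S.p] := fun i => ((2 * i + 1 : ℕ) : ℚ_[S.p]) with hnode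
  set nodes : Finset ℚ_[S.p] := (range kpts).image node with hnodes
  have hmem : ∀ a ∈ nodes, ∃ i < kpts, a = node i := by
    intro a ha
    obtain ⟨i, hi, rfl⟩ := mem_image.mp ha
    exact ⟨i, mem_range.mp hi, rfl⟩
  have hnod : ∀ a ∈ nodes, ‖a‖ ≤ 1 := by
    intro a ha; obtain ⟨i, -, rfl⟩ := hmem a ha; exact hnat _
  -- differences of nodes are the integers `2(i − i')`
  have hdiff : ∀ i i' : ℕ, node i - node i' = ((2 * ((i : ℤ) - i') : ℤ) : ℚ_[S.p]) := by
    intro i i'; simp only [hnode]; push_cast; ring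
  -- the level structure: radii `R0 j = p^{-j}`, levels `R j = R0 (min j Jm)`, `Jm = ⌊log_p (2 kpts)⌋`
  -- (constant beyond the largest valuation of a difference of nodes, so those levels are free)
  set R0 : ℕ → ℝ := fun j => ((S.p : ℝ)⁻¹) ^ j with hR0def
  have hR0pos : ∀ j, 0 < R0 j := fun j => by simp only [hR0def]; positivity
  have hR0anti : ∀ a b, a ≤ b → R0 b ≤ R0 a := fun a b hab => by
    simp only [hR0def]
    exact pow_le_pow_of_le_one (by positivity) (inv_le_one_of_one_le₀ S.one_lt_p.le) hab
  have hR0ratio : ∀ j, R0 j / R0 (j + 1) = S.p := by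
    intro j; simp only [hR0def, pow_succ]; field_simp
  have hR0zpow : ∀ j : ℕ, R0 j = (S.p : ℝ) ^ (-(j : ℤ)) := fun j => by
    simp only [hR0def, zpow_neg, zpow_natCast, inv_pow]
  set Jm : ℕ := Nat.log S.p (2 * kpts) with hJm
  set R : ℕ → ℝ := fun j => R0 (min j Jm) with hR
  have hR0 : R 0 = 1 := by simp [hR, hR0def]
  have hRpos : ∀ j, 0 < R j := fun j => hR0pos _
  have hRanti : ∀ j, R (j + 1) ≤ R j := fun j =>
    hR0anti _ _ (min_le_min (Nat.le_succ j) le_rfl)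
  have hlev : ∀ a ∈ nodes, ∀ a' ∈ nodes, a ≠ a' → ∃ j < Jm + 1, ‖a - a'‖ = R j := by
    intro a ha a' ha' hne
    obtain ⟨i, hi, rfl⟩ := hmem a ha
    obtain ⟨i', hi', rfl⟩ := hmem a' ha'
    set m : ℤ := 2 * ((i : ℤ) - i') with hm
    have hm0 : m ≠ 0 := by
      intro h0; apply hne
      have : (i : ℤ) = i' := by omega
      have : i = i' := by exact_mod_cast this
      rw [this]
    have hmabs : m.natAbs ≤ 2 * kpts := by omega
    -- `v = ord_p m ≤ Jm` since `p^v ≤ |m| ≤ 2 kpts`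
    have hdvd : S.p ^ padicValInt S.p m ∣ m.natAbs := by
      have h1 := Int.natAbs_dvd_natAbs.mpr (padicValInt_dvd (p := S.p) m)
      simpa [Int.natAbs_pow] using h1
    have hvle : padicValInt S.p m ≤ Jm := by
      have h2 : S.p ^ padicValInt S.p m ≤ 2 * kpts :=
        (Nat.le_of_dvd (Int.natAbs_pos.mpr hm0) hdvd).trans hmabs
      exact Nat.le_log_of_pow_le hprime.one_lt h2
    refine ⟨padicValInt S.p m, by omega, ?_⟩
    have hRv : R (padicValInt S.p m) = R0 (padicValInt S.p m) := by
      simp only [hR, min_eq_left hvle]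
    rw [hRv, hdiff, hR0zpow]
    have : ((m : ℚ) : ℚ_[S.p]) = (m : ℚ_[S.p]) := by push_cast; rfl
    rw [← this, S.norm_ratCast_eq (by exact_mod_cast hm0), padicValRat.of_int]
  -- (c) the jets at the nodes (sharp size of `1/k!`)
  set εj : ℝ := Q * ‖S.Λ₀‖ * Pt with hεj
  have hεj0 : 0 ≤ εj := by positivity
  have hjet : ∀ a ∈ nodes, ∀ k < t, ‖∑' n, PadicNewton.ddList (List.replicate k a) b n * a ^ n‖ ≤ εj := by
    intro a ha k hkt
    obtain ⟨i, hi, rfl⟩ := hmem a ha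
    have hj := S.norm_jet_F_le J₀ J box p (hnat (2 * i + 1)) (Tlo - 1) (by positivity)
      (fun τ' hτ' => hval i hi τ' hτ') k τ (by omega)
    change ‖PadicNewton.jet _ b k‖ ≤ εj
    refine hj.trans ?_
    rw [hεj, mul_comm]
    refine mul_le_mul_of_nonneg_left ?_ (by positivity)
    refine (S.norm_inv_factorial_le_pow_div k).trans (pow_le_pow_right₀ h1p ?_)
    exact Nat.div_le_div_right (by omega)
  -- the node sequence: each node `t` times
  have hcast_inj : Function.Injective node := by
    intro i i' hii'
    have h' : (2 * i + 1 : ℕ) = 2 * i' + 1 := Nat.cast_injective (R := ℚ_[S.p]) hii'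
    omega
  set xs : List ℚ_[S.p] := nodeSeq node kpts t with hxs
  have hxs_mem : ∀ x ∈ xs, x ∈ nodes := by
    intro x hx
    obtain ⟨i, hi, rfl⟩ := mem_nodeSeq hx
    exact mem_image.mpr ⟨i, by simpa using hi, rfl⟩
  have hxs_len : xs.length = kpts * t := length_nodeSeq node kpts t
  have hxs_cnt : ∀ a ∈ nodes, xs.count a ≤ t := by
    intro a ha
    obtain ⟨i, hi, rfl⟩ := hmem a ha
    rw [hxs, count_nodeSeq hcast_inj t kpts i, if_pos hi]
  -- (c') the conditioning: nodes within `p^{-j}` of `node i₀` have `i ≡ i₀ (mod p^j)`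
  have hball : ∀ j : ℕ, 1 ≤ j → PadicNewton.ballCount nodes (R0 j) xs ≤ t * (kpts / S.p ^ j + 1) := by
    intro j hj
    unfold PadicNewton.ballCount
    refine Finset.sup_le fun a ha => ?_
    obtain ⟨i₀, hi₀, rfl⟩ := hmem a ha
    rw [hxs, countP_nodeSeq]
    -- `∑ ite ≤ t · #{i : i % p^j = i₀ % p^j}`
    have hsub : ∀ i ∈ range kpts, decide (‖node i - node i₀‖ ≤ R0 j) = true → i % S.p ^ j = i₀ % S.p ^ j := by
      intro i _ hdec
      have hle : ‖node i - node i₀‖ ≤ R0 j := of_decide_eq_true hdec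
      rw [hdiff, hR0zpow, Padic.norm_int_le_pow_iff_dvd] at hle
      -- `p^j ∣ 2 (i − i₀)` and `p` odd give `p^j ∣ i − i₀`
      have hcop : IsCoprime ((S.p : ℤ) ^ j) 2 := by
        refine IsCoprime.pow_left ?_
        rw [Int.isCoprime_iff_gcd_eq_one, Int.gcd_comm]
        have : Nat.Coprime 2 S.p := (Nat.coprime_primes Nat.prime_two hprime).mpr (by have := S.hp3; omega)
        simpa [Int.gcd] using this
      have hdvd : ((S.p : ℤ) ^ j) ∣ (i : ℤ) - i₀ := hcop.dvd_of_dvd_mul_left hle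
      have hmod : i₀ ≡ i [MOD S.p ^ j] := Nat.modEq_iff_dvd.mpr (by push_cast; exact hdvd)
      exact hmod.symm
    calc ∑ i ∈ range kpts, (if decide (‖node i - node i₀‖ ≤ R0 j) = true then t else 0)
        ≤ ∑ i ∈ range kpts, (if i % S.p ^ j = i₀ % S.p ^ j then t else 0) := by
          refine sum_le_sum fun i hi => ?_
          by_cases hd : decide (‖node i - node i₀‖ ≤ R0 j) = true
          · rw [if_pos hd, if_pos (hsub i hi hd)]
          · rw [if_neg hd]; positivity
      _ = t * ((range kpts).filter fun i => i % S.p ^ j = i₀ % S.p ^ j).card := by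
          rw [← Finset.sum_filter]; simp [mul_comm]
      _ ≤ t * (kpts / S.p ^ j + 1) :=
          Nat.mul_le_mul_left _ (card_filter_range_mod_le kpts _ _)
  have hcond : ∏ j ∈ range (Jm + 1), (R j / R (j + 1)) ^ PadicNewton.ballCount nodes (R (j + 1)) xs ≤
      (S.p : ℝ) ^ condExp S.p kpts t := by
    -- the last level is free: `R Jm = R (Jm + 1)`
    rw [Finset.prod_range_succ]
    have hlast : R Jm / R (Jm + 1) = 1 := by
      simp only [hR, min_eq_left (le_refl Jm), min_eq_right (Nat.le_succ Jm), div_self (hR0pos _).ne']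
    rw [hlast, one_pow, mul_one]
    -- the lower levels: ratio `p`, exponent `ballCount (R0 (j+1))`
    have hin : ∀ j ∈ range Jm, (R j / R (j + 1)) ^ PadicNewton.ballCount nodes (R (j + 1)) xs =
        (S.p : ℝ) ^ PadicNewton.ballCount nodes (R0 (j + 1)) xs := by
      intro j hj
      have hj' : j + 1 ≤ Jm := mem_range.mp hj
      simp only [hR, min_eq_left (Nat.le_of_succ_le hj'), min_eq_left hj', hR0ratio]
    rw [Finset.prod_congr rfl hin, Finset.prod_pow_eq_pow_sum]
    refine pow_le_pow_right₀ (by exact_mod_cast hprime.one_lt.le) ?_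
    unfold condExp
    exact sum_le_sum fun j _ => hball (j + 1) (by omega)
  -- (d) the small-jets Schwarz lemma (level version) at `z`
  have hschwarz := PadicNewton.norm_tsum_le_max_of_small_jets_levels hρ h1ρ le_rfl hbB nodes hnod
    R hR0 hRpos hRanti (Jm + 1) hlev hεj0 hjet xs hxs_mem hxs_cnt hz
  have hzlt : ‖z‖ < ρ := lt_of_le_of_lt hz h1ρ
  have hF : ‖S.F J₀ J box p τ z‖ ≤
      max (εj * ∏ j ∈ range (Jm + 1), (R j / R (j + 1)) ^ PadicNewton.ballCount nodes (R (j + 1)) xs)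
        (B / ρ ^ xs.length * (xs.map fun x => ‖z - x‖).prod) := by
    rw [S.F_eq_tsum J₀ J box p τ hzlt]; exact hschwarz
  -- simplify the two terms
  have hprod : (xs.map fun x => ‖z - x‖).prod ≤ 1 := by
    have h := List.prod_map_le_prod_map₀ (s := xs) (fun x => ‖z - x‖)
      (fun _ => (1 : ℝ)) (fun x _ => norm_nonneg _) (fun x hx => by
        rw [sub_eq_add_neg]
        exact (norm_add_le_max _ _).trans (max_le hz (by rw [norm_neg]; exact hnod x (hxs_mem x hx))))
    simpa using h
  have hterm1 : εj * ∏ j ∈ range (Jm + 1), (R j / R (j + 1)) ^ PadicNewton.ballCount nodes (R (j + 1)) xs ≤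
      Q * ‖S.Λ₀‖ * Pt * (S.p : ℝ) ^ condExp S.p kpts t :=
    mul_le_mul_of_nonneg_left hcond hεj0
  have hterm2 : B / ρ ^ xs.length * (xs.map fun x => ‖z - x‖).prod ≤ B / ρ ^ (kpts * t) := by
    rw [hxs_len]
    exact mul_le_of_le_one_right (by positivity) hprod
  have hF' : ‖S.F J₀ J box p τ z‖ ≤
      max (Q * ‖S.Λ₀‖ * Pt * (S.p : ℝ) ^ condExp S.p kpts t) (B / ρ ^ (kpts * t)) :=
    hF.trans (max_le_max hterm1 hterm2)
  refine ⟨hF', ?_⟩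
  -- `‖φ‖ ≤ max(‖f‖, ‖f − φ‖)`
  have e : S.Φ J₀ J box p τ z = S.F J₀ J box p τ z + -(S.F J₀ J box p τ z - S.Φ J₀ J box p τ z) := by
    ring
  rw [e]
  refine (norm_add_le_max _ _).trans (max_le hF' ?_)
  rw [norm_neg]
  refine (hFΦ τ _ hz).trans (le_max_of_le_left ?_)
  have h1 : (1 : ℝ) ≤ Pt := one_le_pow₀ h1p
  have h2 : (1 : ℝ) ≤ (S.p : ℝ) ^ condExp S.p kpts t := one_le_pow₀ h1p
  calc Q * ‖S.Λ₀‖ = Q * ‖S.Λ₀‖ * 1 * 1 := by ring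
    _ ≤ Q * ‖S.Λ₀‖ * Pt * (S.p : ℝ) ^ condExp S.p kpts t := by gcongr

/-! ### The k-step -/

/-- **The `p`-adic k-step** (twin of `Waldschmidt1980.…w80_kstep`). Let the rational cores
`coreSum_{J,τ''}(2i+1)` vanish for `i < kpts`, `|τ''| < Tlo`, let `‖Λ₀‖_p ≤ p⁻¹`, and let the
caller supply, for every `|τ| + t ≤ Tlo` and odd `s₁ < 4 kpts`, a denominator `0 < D ≤ Dmax` with
`D · coreSum_{J,τ}(s₁) ∈ ℤ` and an archimedean bound `|coreSum_{J,τ}(s₁)| ≤ Mmax`. If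
`max (p^{⌊hLb/(p−1)⌋} ‖Λ₀‖ p^{⌊(t−1)/(p−1)⌋} p^{condExp}) (p^{hLb} / (√p)^{kpts·t}) < 1/(Dmax · Mmax)` then
`coreSum_{J,τ}(s₁) = 0` for all odd `s₁ < 4 kpts` and `|τ| + t ≤ Tlo` (product formula,
`Rat.eq_zero_of_padicNorm_lt`). [cite: Yu1990, §3] [cite: Waldschmidt1980, Lemma 3.5 (p. 270)] -/
theorem padic_kstep (J₀ J : ℕ) (box : Finset (Idx S.d h Lb)) (p : Idx S.d h Lb → ℤ)
    {kpts Tlo t : ℕ} (ht : 1 ≤ t)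
    (hzero : ∀ i < kpts, ∀ τ'' : Tau S.d, tauNorm τ'' < Tlo →
      S.coreSum J₀ J box p τ'' (2 * i + 1) = 0)
    (hΛ : ‖S.Λ₀‖ ≤ (S.p : ℝ)⁻¹)
    {Dmax Mmax : ℝ}
    (hDM : ∀ τ : Tau S.d, tauNorm τ + t ≤ Tlo → ∀ s₁, s₁ < 4 * kpts → Odd s₁ →
      ∃ D : ℕ, 0 < D ∧ (D : ℝ) ≤ Dmax ∧ (∃ m : ℤ, (D : ℚ) * S.coreSum J₀ J box p τ s₁ = m) ∧
        |(S.coreSum J₀ J box p τ s₁ : ℝ)| ≤ Mmax)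
    (hfinal : max ((S.p : ℝ) ^ (h * Lb / (S.p - 1)) * ‖S.Λ₀‖ * (S.p : ℝ) ^ ((t - 1) / (S.p - 1)) *
          (S.p : ℝ) ^ condExp S.p kpts t)
        ((S.p : ℝ) ^ (h * Lb) / Real.sqrt S.p ^ (kpts * t)) < 1 / (Dmax * Mmax)) :
    ∀ s₁, s₁ < 4 * kpts → Odd s₁ → ∀ τ : Tau S.d, tauNorm τ + t ≤ Tlo →
      S.coreSum J₀ J box p τ s₁ = 0 := by
  intro s₁ hs₁ hodd τ hτ
  have hz : ‖((s₁ : ℕ) : ℚ_[S.p])‖ ≤ 1 := by exact_mod_cast Padic.norm_int_le_one (p := S.p) (s₁ : ℤ)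
  have hcore := (S.norm_Φ_le_of_zeros J₀ J box p ht hzero hΛ hz τ hτ).2
  rw [S.Φ_natCast] at hcore
  obtain ⟨D, hD0, hDle, ⟨m, hm⟩, hM⟩ := hDM τ hτ s₁ hs₁ hodd
  exact Rat.eq_zero_of_padicNorm_lt (p := S.p) hD0 hDle hm hM (lt_of_le_of_lt hcore hfinal)

end Setup

end PadicCW77

end Literature.NumberTheory.Transcendental

end
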